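import Summits.MatrixMultiplication.MatrixMultiplication.Theorems.OutsiderSandwichColumnDisjoint
import HarnessLib

/-!
# The column-disjoint bound is attained at level two: an explicit integer certificate

Route `OutsiderSandwich` (decomposition cell `decomp-mm`, lens 4 «minimal counterexample /
extremal reduction», gen 27), support for the aside leaf `BlockOneIsMM`
(stmt-MatrixMultiplication-27147); the cut of record is untouched.  Theorem-only file (no
definition, no instance, no Literature notion).

`OutsiderSandwichColumnDisjoint.four_pow_le_card_mul_three_pow` says a column-disjoint
sign-untwisted certificate `⟨B⟩ ⊠ C₁^{⊠N} ≥ ⟨2^N, 2^N, 2^N⟩` has `4^N ≤ B · 3^N`; at `N = 2` this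
allows `B = 2` (`16 ≤ 18`) and forbids `B = 1`.  This file EXHIBITS such a certificate with `B = 2`,
over any field and with integer (`0, ±1`) data, in exactly the hypothesis shape of that theorem
(`levelTwo_certificate_exists`), and feeds it back to the theorem (`levelTwo_bound_attained`):
the class bounded by the no-go is inhabited below the trivial `B = 2^N`, and the bound is attained
at `N = 2` (as at `N = 1`).  The certificate is a SANDWICH COVERING of `M₄ = M₂ ⊗ M₂` by two
copies of the twist-invariants `𝐒 = Sym₂ ⊗ Sym₂` (`9 + 9 = 18 ≥ 16`, overlap `2`):
`X = S₁ X + P_swap · S₂ X · P_flip`, with `S₁ X, S₂ X ∈ 𝐒` (invariant under all four partial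
transposes, so every block is sign-untwisted with `ε = +1`: the certificate restricts through the
symmetric core), `P_swap` the permutation matrix of the bit swap `(a,b) ↦ (b,a)` and `P_flip` that
of `(a,b) ↦ (a,b+1)`; block `(i,c)` (copy `i`, twist pattern `c`) is wired to column `c`, vector
legs `1, 1` for copy `0` and `P_swap, P_flip` for copy `1`.  Writing `Xab_a'b'` for the entry of `X`
in row `(a,b)` and column `(a',b')` (rows / columns ordered `00, 01, 10, 11`):

    S₁ X = [ X00_00 − X10_01 + X11_00 , X01_00 , X00_10 , X11_00 ;
             X01_00 , −X00_11 + X01_01 + X11_00 , X11_00 , X11_01 ;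
             X00_10 , X11_00 , X10_10 , X10_11 ;
             X11_00 , X11_01 , X10_11 , −X01_10 + X11_00 + X11_11 ]
    S₂ X = [ X00_01 − X01_00 , X10_01 − X11_00 , X00_11 − X11_00 , 0 ;
             X10_01 − X11_00 , −X00_10 + X10_00 , 0 , 0 ;
             X00_11 − X11_00 , 0 , X01_11 − X11_01 , X01_10 − X11_00 ;
             0 , 0 , X01_10 − X11_00 , −X10_11 + X11_10 ]

Prior art IN THE TREE: the level-two symmetric cover `K^{4×4} = 𝐒 + P·𝐒` with a LEFT permutation
`P` (rows `(i,i') ↦ (i', i+1)`) and an integer certificate checked by `decide` is lens 2's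
`FarEdgeDescentSymmetricCoverCore.cover_identity` (g30), docked into the exchange ladder as
`OutsiderSandwichExchangeLevelTwo.exchangeNumber_two` (`r(2) = 2`); no Kronecker-product sandwich
`(g ⊗ g') · 𝐒 · (h ⊗ h')` can serve as the second translate (loc. cit.).  What is added here is the
statement in the twist formalism of this lineage (`Idx`, `ptrans`; a two-sided permutation sandwich)
and the DOCKING into the column-disjoint sign-untwisted hypothesis shape (non-vacuity of that no-go
at `(N, B) = (2, 2)` and tightness of its bound there).  Memo-level context (NODE-g27 §1.5, not
formalised): sandwich coverings of `M_{2^N}` by `B` translates `G_j · Sym₂^{⊗N} · H_j` are the same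
thing as through-the-core column-disjoint certificates with `B` copies, they tensor
(`κ(a+b) ≤ κ(a)κ(b)`), and exact computation gives `κ(N) = ⌈(4/3)^N⌉` for `N ≤ 5`.

## References

* M. Bläser, *Fast Matrix Multiplication*, Theory of Computing Graduate Surveys 5 (2013), §5.
  [Blaser2013]
* J.-P. Serre, *Linear Representations of Finite Groups*, GTM 42 (1977), §2.6 (isotypic
  components; `Sym₂ ⊗ Sym₂` is the invariant one). [Serre1977]
-/

noncomputable section

open scoped BigOperators Matrix

set_option linter.dupNamespace false
set_option autoImplicit false

namespace Summit.MatrixMultiplication.MatrixMultiplication.Theorems.OutsiderSandwichColumnDisjointLevelTwo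

open Summit.MatrixMultiplication.MatrixMultiplication.Theorems.OutsiderSandwichTwistGluing
  Summit.MatrixMultiplication.MatrixMultiplication.Theorems.OutsiderSandwichColumnDisjoint

universe u

variable {K : Type u} [Field K]

/-- Case analysis on a two-bit index `r : Idx 2 = Fin 2 → Fin 2`. -/
theorem idx2_cases {P : Idx 2 → Prop} (h00 : P ![0, 0]) (h01 : P ![0, 1]) (h10 : P ![1, 0])
    (h11 : P ![1, 1]) (r : Idx 2) : P r := by
  have hr : r = ![r 0, r 1] := by ext i; fin_cases i <;> rfl
  rw [hr]
  generalize r 0 = a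
  generalize r 1 = b
  fin_cases a <;> fin_cases b <;> assumption

/-- The sandwich by the permutation matrices of the bit swap (left) and of the second-bit flip
(right) is a re-indexing: `(P_swap · Y · P_flip) r s = Y (r 1, r 0) (s 0, s 1 + 1)`. -/
theorem perm_sandwich_apply (Y : Matrix (Idx 2) (Idx 2) K) (r s : Idx 2) :
    ((Matrix.of fun r r' : Idx 2 => if r' = ![r 1, r 0] then (1 : K) else 0) * Y *
        (Matrix.of fun s' s : Idx 2 => if s' = ![s 0, s 1 + 1] then (1 : K) else 0)) r s =
      Y ![r 1, r 0] ![s 0, s 1 + 1] := by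
  simp only [Matrix.mul_apply, Matrix.of_apply, ite_mul, one_mul, zero_mul, mul_ite, mul_one,
    mul_zero, Finset.sum_ite_eq', Finset.mem_univ, if_true]

set_option maxHeartbeats 1600000 in
/-- **A column-disjoint sign-untwisted certificate with two copies at level two**, in exactly the
hypothesis shape (`ident`, `hSU`) of `OutsiderSandwichColumnDisjoint.four_pow_le_card_mul_three_pow`
with `N = 2`, `ι = Fin 2`: `x`-leg maps `![S₁, S₂]` (the tables of the module docstring), block
`(i, c)` wired to column `c` (`col i c = some c`: column-disjoint, no idle block), vector legs
`G 0 c = H 0 c = 1`, `G 1 c = P_swap`, `H 1 c = P_flip`, every block sign-untwisted with `ε = 1`. -/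
theorem levelTwo_certificate_exists :
    ∃ (A : Fin 2 → (Matrix (Idx 2) (Idx 2) K →ₗ[K] Matrix (Idx 2) (Idx 2) K))
      (col : Fin 2 → Idx 2 → Option (Idx 2))
      (G H : Fin 2 → Idx 2 → Matrix (Idx 2) (Idx 2) K),
      (∀ (d : Idx 2) (X : Matrix (Idx 2) (Idx 2) K),
          ∑ b ∈ Finset.univ.filter (fun b : Fin 2 × Idx 2 => col b.1 b.2 = some d),
            G b.1 b.2 * ptrans b.2 (A b.1 X) * H b.1 b.2 = X) ∧
      (∀ (i : Fin 2) (c : Idx 2), col i c = some c) ∧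
      (∀ (i : Fin 2) (c : Idx 2), col i c ≠ none →
          ∃ ε : K, ∀ X : Matrix (Idx 2) (Idx 2) K, ptrans c (A i X) = ε • A i X) := by
  have h11 : (1 : Fin 2) + 1 = 0 := rfl
  have h01 : (0 : Fin 2) + 1 = 1 := rfl
  -- the two `x`-leg maps, known only through their entry tables
  obtain ⟨L₁, app₁⟩ : ∃ L : Matrix (Idx 2) (Idx 2) K →ₗ[K] Matrix (Idx 2) (Idx 2) K,
      ∀ (X : Matrix (Idx 2) (Idx 2) K) (r s : Idx 2), L X r s =
        (match r 0, r 1, s 0, s 1 with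
          | 0, 0, 0, 0 => X ![0, 0] ![0, 0] - X ![1, 0] ![0, 1] + X ![1, 1] ![0, 0]
          | 0, 0, 0, 1 => X ![0, 1] ![0, 0]
          | 0, 0, 1, 0 => X ![0, 0] ![1, 0]
          | 0, 0, 1, 1 => X ![1, 1] ![0, 0]
          | 0, 1, 0, 0 => X ![0, 1] ![0, 0]
          | 0, 1, 0, 1 => -X ![0, 0] ![1, 1] + X ![0, 1] ![0, 1] + X ![1, 1] ![0, 0]
          | 0, 1, 1, 0 => X ![1, 1] ![0, 0]
          | 0, 1, 1, 1 => X ![1, 1] ![0, 1]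
          | 1, 0, 0, 0 => X ![0, 0] ![1, 0]
          | 1, 0, 0, 1 => X ![1, 1] ![0, 0]
          | 1, 0, 1, 0 => X ![1, 0] ![1, 0]
          | 1, 0, 1, 1 => X ![1, 0] ![1, 1]
          | 1, 1, 0, 0 => X ![1, 1] ![0, 0]
          | 1, 1, 0, 1 => X ![1, 1] ![0, 1]
          | 1, 1, 1, 0 => X ![1, 0] ![1, 1]
          | 1, 1, 1, 1 => -X ![0, 1] ![1, 0] + X ![1, 1] ![0, 0] + X ![1, 1] ![1, 1]
          | _, _, _, _ => 0
          : K) :=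
    ⟨{ toFun := fun X => Matrix.of (fun r s : Idx 2 =>
          match r 0, r 1, s 0, s 1 with
            | 0, 0, 0, 0 => X ![0, 0] ![0, 0] - X ![1, 0] ![0, 1] + X ![1, 1] ![0, 0]
            | 0, 0, 0, 1 => X ![0, 1] ![0, 0]
            | 0, 0, 1, 0 => X ![0, 0] ![1, 0]
            | 0, 0, 1, 1 => X ![1, 1] ![0, 0]
            | 0, 1, 0, 0 => X ![0, 1] ![0, 0]
            | 0, 1, 0, 1 => -X ![0, 0] ![1, 1] + X ![0, 1] ![0, 1] + X ![1, 1] ![0, 0]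
            | 0, 1, 1, 0 => X ![1, 1] ![0, 0]
            | 0, 1, 1, 1 => X ![1, 1] ![0, 1]
            | 1, 0, 0, 0 => X ![0, 0] ![1, 0]
            | 1, 0, 0, 1 => X ![1, 1] ![0, 0]
            | 1, 0, 1, 0 => X ![1, 0] ![1, 0]
            | 1, 0, 1, 1 => X ![1, 0] ![1, 1]
            | 1, 1, 0, 0 => X ![1, 1] ![0, 0]
            | 1, 1, 0, 1 => X ![1, 1] ![0, 1]
            | 1, 1, 1, 0 => X ![1, 0] ![1, 1]
            | 1, 1, 1, 1 => -X ![0, 1] ![1, 0] + X ![1, 1] ![0, 0] + X ![1, 1] ![1, 1]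
            | _, _, _, _ => 0),
        map_add' := by
          intro X Y
          ext r s
          simp only [Matrix.of_apply, Matrix.add_apply]
          induction r using idx2_cases <;> induction s using idx2_cases <;>
            simp only [Matrix.cons_val_zero, Matrix.cons_val_one] <;> ring,
        map_smul' := by
          intro a X
          ext r s
          simp only [Matrix.of_apply, Matrix.smul_apply, smul_eq_mul, RingHom.id_apply]
          induction r using idx2_cases <;> induction s using idx2_cases <;>
            simp only [Matrix.cons_val_zero, Matrix.cons_val_one] <;> ring },
      fun _ _ _ => rfl⟩
  obtain ⟨L₂, app₂⟩ : ∃ L : Matrix (Idx 2) (Idx 2) K →ₗ[K] Matrix (Idx 2) (Idx 2) K,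
      ∀ (X : Matrix (Idx 2) (Idx 2) K) (r s : Idx 2), L X r s =
        (match r 0, r 1, s 0, s 1 with
          | 0, 0, 0, 0 => X ![0, 0] ![0, 1] - X ![0, 1] ![0, 0]
          | 0, 0, 0, 1 => X ![1, 0] ![0, 1] - X ![1, 1] ![0, 0]
          | 0, 0, 1, 0 => X ![0, 0] ![1, 1] - X ![1, 1] ![0, 0]
          | 0, 0, 1, 1 => 0
          | 0, 1, 0, 0 => X ![1, 0] ![0, 1] - X ![1, 1] ![0, 0]
          | 0, 1, 0, 1 => -X ![0, 0] ![1, 0] + X ![1, 0] ![0, 0]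
          | 0, 1, 1, 0 => 0
          | 0, 1, 1, 1 => 0
          | 1, 0, 0, 0 => X ![0, 0] ![1, 1] - X ![1, 1] ![0, 0]
          | 1, 0, 0, 1 => 0
          | 1, 0, 1, 0 => X ![0, 1] ![1, 1] - X ![1, 1] ![0, 1]
          | 1, 0, 1, 1 => X ![0, 1] ![1, 0] - X ![1, 1] ![0, 0]
          | 1, 1, 0, 0 => 0
          | 1, 1, 0, 1 => 0
          | 1, 1, 1, 0 => X ![0, 1] ![1, 0] - X ![1, 1] ![0, 0]
          | 1, 1, 1, 1 => -X ![1, 0] ![1, 1] + X ![1, 1] ![1, 0]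
          | _, _, _, _ => 0
          : K) :=
    ⟨{ toFun := fun X => Matrix.of (fun r s : Idx 2 =>
          match r 0, r 1, s 0, s 1 with
            | 0, 0, 0, 0 => X ![0, 0] ![0, 1] - X ![0, 1] ![0, 0]
            | 0, 0, 0, 1 => X ![1, 0] ![0, 1] - X ![1, 1] ![0, 0]
            | 0, 0, 1, 0 => X ![0, 0] ![1, 1] - X ![1, 1] ![0, 0]
            | 0, 0, 1, 1 => 0
            | 0, 1, 0, 0 => X ![1, 0] ![0, 1] - X ![1, 1] ![0, 0]
            | 0, 1, 0, 1 => -X ![0, 0] ![1, 0] + X ![1, 0] ![0, 0]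
            | 0, 1, 1, 0 => 0
            | 0, 1, 1, 1 => 0
            | 1, 0, 0, 0 => X ![0, 0] ![1, 1] - X ![1, 1] ![0, 0]
            | 1, 0, 0, 1 => 0
            | 1, 0, 1, 0 => X ![0, 1] ![1, 1] - X ![1, 1] ![0, 1]
            | 1, 0, 1, 1 => X ![0, 1] ![1, 0] - X ![1, 1] ![0, 0]
            | 1, 1, 0, 0 => 0
            | 1, 1, 0, 1 => 0
            | 1, 1, 1, 0 => X ![0, 1] ![1, 0] - X ![1, 1] ![0, 0]
            | 1, 1, 1, 1 => -X ![1, 0] ![1, 1] + X ![1, 1] ![1, 0]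
            | _, _, _, _ => 0),
        map_add' := by
          intro X Y
          ext r s
          simp only [Matrix.of_apply, Matrix.add_apply]
          induction r using idx2_cases <;> induction s using idx2_cases <;>
            simp only [Matrix.cons_val_zero, Matrix.cons_val_one] <;> ring,
        map_smul' := by
          intro a X
          ext r s
          simp only [Matrix.of_apply, Matrix.smul_apply, smul_eq_mul, RingHom.id_apply]
          induction r using idx2_cases <;> induction s using idx2_cases <;>
            simp only [Matrix.cons_val_zero, Matrix.cons_val_one] <;> ring },
      fun _ _ _ => rfl⟩
  -- both maps take values in the twist-invariants `Sym₂ ⊗ Sym₂`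
  have inv₁ : ∀ (c : Idx 2) (X : Matrix (Idx 2) (Idx 2) K), ptrans c (L₁ X) = L₁ X := by
    intro c X
    ext r s
    rw [ptrans_apply, app₁, app₁]
    induction c using idx2_cases <;> induction r using idx2_cases <;>
      induction s using idx2_cases <;>
        simp only [twist, Matrix.cons_val_zero, Matrix.cons_val_one, if_true, if_false,
          zero_ne_one]
  have inv₂ : ∀ (c : Idx 2) (X : Matrix (Idx 2) (Idx 2) K), ptrans c (L₂ X) = L₂ X := by
    intro c X
    ext r s
    rw [ptrans_apply, app₂, app₂]
    induction c using idx2_cases <;> induction r using idx2_cases <;>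
      induction s using idx2_cases <;>
        simp only [twist, Matrix.cons_val_zero, Matrix.cons_val_one, if_true, if_false,
          zero_ne_one]
  -- the covering identity `X = L₁ X + P_swap · L₂ X · P_flip`
  have cov : ∀ X : Matrix (Idx 2) (Idx 2) K,
      L₁ X + (Matrix.of fun r r' : Idx 2 => if r' = ![r 1, r 0] then (1 : K) else 0) * L₂ X *
        (Matrix.of fun s' s : Idx 2 => if s' = ![s 0, s 1 + 1] then (1 : K) else 0) = X := by
    intro X
    ext r s
    rw [Matrix.add_apply, perm_sandwich_apply, app₁, app₂]
    induction r using idx2_cases <;> induction s using idx2_cases <;>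
      (simp only [Matrix.cons_val_zero, Matrix.cons_val_one, h11, h01]; ring)
  refine ⟨![L₁, L₂], fun _ c => some c,
    ![fun _ => 1, fun _ => Matrix.of fun r r' : Idx 2 => if r' = ![r 1, r 0] then (1 : K) else 0],
    ![fun _ => 1, fun _ => Matrix.of fun s' s : Idx 2 => if s' = ![s 0, s 1 + 1] then (1 : K) else 0],
    ?_, fun _ _ => rfl, ?_⟩
  · intro d X
    rw [Finset.sum_filter, Fintype.sum_prod_type, Fin.sum_univ_two]
    simp only [Option.some.injEq, Finset.sum_ite_eq', Finset.mem_univ, if_true,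
      Matrix.cons_val_zero, Matrix.cons_val_one, inv₁, inv₂, one_mul, mul_one]
    exact cov X
  · intro i c _
    refine ⟨1, fun X => ?_⟩
    fin_cases i
    · simp [inv₁]
    · simp [inv₂]

/-- **The column-disjoint bound is attained at `N = 2`.**  Feeding the certificate of
`levelTwo_certificate_exists` (over `ℚ`) to `four_pow_le_card_mul_three_pow` returns its bound
`4 ^ 2 ≤ card (Fin 2) · 3 ^ 2`, i.e. `16 ≤ 18`: two copies are sufficient at level two, and
necessary in the class (`16 > 1 · 9`), exactly as at level one (`4 ≤ 6`,
`OutsiderSandwichColumnDisjoint.trivial_bound`): the covering numbers start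
`κ(1) = κ(2) = 2 = ⌈(4/3)^N⌉` (cf. `OutsiderSandwichExchangeLevelTwo.exchangeNumber_one_two` for the
unrestricted exchange numbers `r(1) = r(2) = 2`). -/
theorem levelTwo_bound_attained :
    4 ^ 2 ≤ Fintype.card (Fin 2) * 3 ^ 2 ∧ ¬ 4 ^ 2 ≤ Fintype.card (Fin 1) * 3 ^ 2 := by
  refine ⟨?_, by simp⟩
  obtain ⟨A, col, G, H, hident, -, hsu⟩ := levelTwo_certificate_exists (K := ℚ)
  exact four_pow_le_card_mul_three_pow A col G H hident hsu

end Summit.MatrixMultiplication.MatrixMultiplication.Theorems.OutsiderSandwichColumnDisjointLevelTwo
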